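import Mathlib
import Summits.Ventures.FusionMHD.Models.SAlphaSecondStableS125A325Core0
import HarnessLib

/-!
# STABLE-POINT core at `((5 / 4), 13/4)`, piece 16 (`[29, 32]`): kernel-decided Taylor-model leaves ⇒ `F_16 > 0` and `amplitudeResidual (5 / 4) (13/4) F_16 F_16″ ≤ 0` on the piece ⇒ `EnergyDominatesOn` for its amplitude phase

LADDER-GRIDFUSION rung F3 («F3.BALLOON-sα-S5o4-SECOND-EDGE-BRACKET»: the first certified point on the SECOND-STABILITY side of the s–α model at shear 5/4 (DIRECTOR RULING 67 (5) class / I4107 (2); second-edge bracket at s = 5/4)); gridfusion-model-7 g10, 2026-08-28 (g8/g9 core lane).  Two `decide +kernel` calls (`OpModel.trig.pLeavesCheck`, scale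
`2^60`, Taylor degree 10, 24 leaves of half-width 1/16) and the lane's soundness theorem `OpSem.trig.pos_of_pLeavesCheck`
(Literature/Analysis/ValidatedNumerics/TaylorModelZeroCert); lit-4's `energyDominatesOn_of_amplitude` (BallooningSAlphaStableSide) turns the two
sign facts into energy domination by `amplitudePhase (5 / 4) (13/4) F_16 F_16′` on the piece.  MODELLED: `s–α` model; nothing about a device.
No `native_decide`.  Citations: Freidberg 2014 §12.6.2 (12.97) [Freidberg2014]; Makino–Berz 2003 Alg. 2 [MakinoBerz2003]; Hartman 2002 XI.6.2
[Hartman2002].  Everything here is [instance data].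
-/

open Literature.Analysis.ValidatedNumerics Literature.Analysis.ValidatedNumerics.PolyMP
open Literature.Analysis.ValidatedNumerics.NumericsMP Literature.Analysis.ValidatedNumerics.ExpPoly
open Literature.MathematicalPhysics.MHD.Ballooning
open Real Set

namespace Summit.Ventures.FusionMHD.Models

namespace SAlphaSecondStableS125A325

/-- KERNEL CHECK (residual leaves of piece 16). [instance data] -/
theorem ss125325_res16_ok : OpModel.trig.pLeavesCheck ss125325Prm (2 ^ 60) (ss125325Prog V16 (Poly.deriv (Poly.deriv V16))) [] ss125325Leaves16 = true := by
  decide +kernel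

/-- KERNEL CHECK (positivity leaves of piece 16). [instance data] -/
theorem ss125325_pos16_ok : OpModel.trig.pLeavesCheck ss125325Prm (2 ^ 60) (ss125325PosProg V16) [] ss125325Leaves16 = true := by
  decide +kernel

/-- The leaves tile `[29, 32]`. [instance data] -/
theorem ss125325_tiles16 : tiles (29 : ℚ) (ss125325Leaves16.map fun l => (l.e, l.k)) (32 : ℚ) = true := by
  decide +kernel

/-- **PIECE 16**: the phase of `F_16` dominates the `s–α` energy on `[29, 32]` at `(s, α) = ((5 / 4), 13/4)`. [instance data] -/
theorem ss125325_dominates16 :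
    SAlpha.EnergyDominatesOn (5 / 4) (13 / 4) (SAlpha.amplitudePhase (5 / 4) (13 / 4) (Poly.eval V16) (Poly.eval (Poly.deriv V16)))
      (Icc (29 : ℝ) (32 : ℝ)) := by
  have h := ss125325_dominates (lf := V16) (x := 29) (y := 32) (by norm_num) ss125325_tiles16 ss125325_res16_ok ss125325_pos16_ok
  norm_num at h
  exact h

end SAlphaSecondStableS125A325

end Summit.Ventures.FusionMHD.Models
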